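import Summits.Ventures.Crystal3D.Theorems.StickyWulffConstantGenericWallFloorRayTerraceB
import Summits.Ventures.Crystal3D.Theorems.StickyWulffConstantGenericWallFloorAtHalf
import HarnessLib

/-!
# The terrace-steered steep family, part 5: `hfar` on the `Σ9` cap — no frame of a terrace-family stack IS a lattice
# presented over the base frame by a two-letter word through the terrace (crux `GenericWallFloor`, line `WallLedgerG`)

HONEST FRAMING. Venture `Summits/Ventures/Crystal3D` (cell `crystal3d-full`), helper `--supports` the crux
`GenericWallFloor` (stmt-Ventures-19480) of `route-Ventures-StickyWulffConstant`, REGISTERED line `WallLedgerG`, open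
stub `stub_twoSlabAdhesion`.  Rung credit only; F-C1 not moved; NOT the stub; census-free, standard axioms.

The W1-conditional one-sided ledgers (19480-p2: `…StackLedgerOneSidedDirs`, `…OneSidedDownDirs`) need, besides `hdirs`
(parts 2–4), `hfar`: no frame of a sound well-formed stack of the family IS the far grain's linear lattice.  On the `Σ9`
cap of lane G's residual the far lattice is presented over the walker's own frame `A` by a TWO-LETTER model word whose
first-applied letter is the terrace normal `±(1,1,1)/√3` (cubic) — and the vertical-steered family's ray enters exactly
that lattice (arrival; this is why the cap is the residual).  The TERRACE-steered family does not:
* **`image_ne_of_terrace_word`** — for a model two-letter word `[κ₀, κ₁]` (unit model menu normals at `±1/3`) with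
  `cubicCoords κ₁ = ±(1,1,1)/√3` and `cubicCoords κ₀ ≠ ±(1,−1,−1)/√3`, and `B·Λ₀ = (wordFrame A [κ₀, κ₁])·Λ₀`: every frame
  of every sound well-formed stack over `⟨A, slotSite 8, 0⟩` for the terrace steering (`cubicCoords (A.symm z) ∥ (34,32,33)`)
  has `F·Λ₀ ≠ B·Λ₀`.  Mechanism (`map_reflection_eq_of_image_eq`, reduced words are rigid): equal lattices force equal
  mirror sequences, hence a stack of exactly two pushes whose letters are `±κ₁, ±κ₀`; the first push normal of the
  family is `(1,1,1)/√3` (ray a) or `(−1,1,1)/√3` (ray b, ≠ ±κ₁), and on ray a the second letter is the level-0 next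
  normal `(5/3,−1/3,−1/3)/√3` pulled back through the terrace mirror, `= (1,−1,−1)/√3` (`rayA_level0`) — `≠ ±κ₀`.
The `Σ9` cap of record has second letter `±(1,1,−5)/(3√3)`-type (the `[110]` tilt partner of the terrace), so the
hypothesis on `κ₀` holds there; the statement is linear (no translation) — it serves every relative translation.
WHAT THIS IS NOT: not the ledger, no packing statement; F-C1 not moved.
-/

noncomputable section

namespace Summit.Ventures.Crystal3D.Theorems

open Summit.Ventures.Crystal3D Finset Matrix
open Literature.MathematicalPhysics.StatisticalMechanics (fccStacking)
open scoped InnerProductSpace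

/-- The word of a stack has one letter per non-bottom entry. -/
theorem length_stackWord : ∀ (e : WalkEntry) (r : List WalkEntry), (stackWord (e :: r)).length = r.length
  | _, [] => rfl
  | _, e' :: r' => by rw [stackWord_cons_cons, List.length_cons, length_stackWord e' r', List.length_cons]

/-- Pulling a vector back through a twin frame: `(twinFrame A n).symm y = A.symm (R_n y)`. -/
theorem twinFrame_symm_apply (A : EuclideanSpace ℝ (Fin 3) ≃ₗᵢ[ℝ] EuclideanSpace ℝ (Fin 3)) (n y : EuclideanSpace ℝ (Fin 3)) :
    (twinFrame A n).symm y = A.symm ((ℝ ∙ n)ᗮ.reflection y) := by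
  rw [twinFrame, LinearIsometryEquiv.symm_trans, LinearIsometryEquiv.trans_apply, Submodule.reflection_symm]

/-- **The second letter of ray a**: the level-0 next normal pulled back through the terrace mirror has cubic
coordinates `(1,−1,−1)/√3`. -/
theorem terrace_letter_one (A : EuclideanSpace ℝ (Fin 3) ≃ₗᵢ[ℝ] EuclideanSpace ℝ (Fin 3))
    {n z : EuclideanSpace ℝ (Fin 3)} {t : ℝ} (hn : ‖n‖ = 1)
    (hmenu : ∀ w ∈ fccSlots, ⟪A w, n⟫_ℝ = 0 ∨ ⟪A w, n⟫_ℝ = Real.sqrt (2 / 3) ∨ ⟪A w, n⟫_ℝ = -Real.sqrt (2 / 3))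
    (hpos : ⟪A (slotSite 8), n⟫_ℝ = Real.sqrt (2 / 3))
    (hPa : cubicCoords (A.symm n) = (Real.sqrt 3)⁻¹ • (![(1 : ℝ), 1, 1] : Fin 3 → ℝ))
    (hZ : cubicCoords (A.symm z) = t • (![(34 : ℝ), 32, 33] : Fin 3 → ℝ)) (ht : 0 < t) :
    cubicCoords ((twinFrame A n).symm (nextNormal (forcedTop z ⟨A, slotSite 8, 0⟩ n 0))) =
      (Real.sqrt 3)⁻¹ • (![(1 : ℝ), -1, -1] : Fin 3 → ℝ) := by
  obtain ⟨hs2, hs3, hs2p, hs3p, h23⟩ := sqrt_two_three_facts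
  obtain ⟨-, hP1⟩ := rayA_level0 A hn hmenu hpos hPa hZ ht
  have hin : ⟪nextNormal (forcedTop z ⟨A, slotSite 8, 0⟩ n 0), n⟫_ℝ = 1 / 3 := by
    rw [inner_eq_cubic_symm A, hP1, hPa, smul_dotProduct, dotProduct_smul, smul_eq_mul, smul_eq_mul]
    norm_num [dotProduct, Fin.sum_univ_three, Matrix.cons_val_zero, Matrix.cons_val_one, Matrix.cons_val_two,
      Matrix.head_cons, Matrix.tail_cons]
    field_simp; linarith [hs3]
  rw [twinFrame_symm_apply, reflection_unit_apply hn, map_sub, cubicCoords_sub, LinearIsometryEquiv.map_smul,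
    cubicCoords_smul, hP1, hin, hPa, smul_smul]
  ext i
  fin_cases i <;> norm_num [Matrix.cons_val_zero, Matrix.cons_val_one, Matrix.cons_val_two, Matrix.head_cons,
    Matrix.tail_cons] <;> field_simp <;> linarith [hs3]

/-- **`hfar` for the terrace family against a two-letter word through the terrace.**  See the module docstring. -/
theorem image_ne_of_terrace_word (A B : EuclideanSpace ℝ (Fin 3) ≃ₗᵢ[ℝ] EuclideanSpace ℝ (Fin 3))
    {z : EuclideanSpace ℝ (Fin 3)} {t : ℝ}
    (hZ : cubicCoords (A.symm z) = t • (![(34 : ℝ), 32, 33] : Fin 3 → ℝ)) (ht : 0 < t)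
    (κ₀ κ₁ : EuclideanSpace ℝ (Fin 3))
    (hκl : ∀ μ ∈ [κ₀, κ₁], ‖μ‖ = 1 ∧
      ∀ w ∈ fccSlots, ⟪w, μ⟫_ℝ = 0 ∨ ⟪w, μ⟫_ℝ = Real.sqrt (2 / 3) ∨ ⟪w, μ⟫_ℝ = -Real.sqrt (2 / 3))
    (hκc : List.IsChain (fun μ μ' => ⟪μ, μ'⟫_ℝ = 1 / 3 ∨ ⟪μ, μ'⟫_ℝ = -1 / 3) [κ₀, κ₁])
    (hκ₁ : cubicCoords κ₁ = (Real.sqrt 3)⁻¹ • (![(1 : ℝ), 1, 1] : Fin 3 → ℝ) ∨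
      cubicCoords κ₁ = -((Real.sqrt 3)⁻¹ • (![(1 : ℝ), 1, 1] : Fin 3 → ℝ)))
    (hκ₀ : cubicCoords κ₀ ≠ (Real.sqrt 3)⁻¹ • (![(1 : ℝ), -1, -1] : Fin 3 → ℝ) ∧
      cubicCoords κ₀ ≠ -((Real.sqrt 3)⁻¹ • (![(1 : ℝ), -1, -1] : Fin 3 → ℝ)))
    (hB : B '' fccStacking 1 (Real.sqrt (2 / 3)) = (wordFrame A [κ₀, κ₁]) '' fccStacking 1 (Real.sqrt (2 / 3))) :
    ∀ stk : List WalkEntry, StackSound z stk → StackWF z stk → stk.getLast? = some ⟨A, slotSite 8, 0⟩ →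
      ∀ e ∈ stk, e.frame '' fccStacking 1 (Real.sqrt (2 / 3)) ≠ B '' fccStacking 1 (Real.sqrt (2 / 3)) := by
  intro stk hS hW hlast e he hEq
  obtain ⟨hs2, hs3, hs2p, hs3p, h23⟩ := sqrt_two_three_facts
  obtain ⟨r, hS', hW', hl'⟩ := exists_suffix_of_mem stk e he hS hW
  rw [hlast] at hl'
  obtain ⟨hαl, hαc⟩ := stackWord_letters _ hS' hW'
  have hF : e.frame = wordFrame A (stackWord (e :: r)) := by
    rw [frame_eq_wordFrame e r hS', stackBase_eq_of_getLast? hl']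
  have himg := image_fccSlots_eq_of_image_fcc_eq _ _ (hEq.trans hB)
  rw [hF] at himg
  have hmap := map_reflection_eq_of_image_eq A hαl hαc hκl hκc himg
  -- the stack has exactly two pushes
  have hlen : r.length = 2 := by
    have h := congrArg List.length hmap
    rw [List.length_map, List.length_map, length_stackWord] at h
    simpa using h
  obtain ⟨e', b, rfl⟩ := List.length_eq_two.1 hlen
  have hb : b = ⟨A, slotSite 8, 0⟩ := by
    rw [List.getLast?_cons_cons, List.getLast?_cons_cons, List.getLast?_singleton, Option.some.injEq] at hl'
    exact hl'
  have hbf : b.frame = A := by rw [hb]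
  have hbd : b.dir = slotSite 8 := by rw [hb]
  obtain ⟨hSo, hLi, hSo', hLi', -⟩ := hS'
  obtain ⟨hdir, hne, hdir', -, -⟩ := hW'
  simp only [stackWord_cons_cons, stackWord_singleton, List.map_cons, List.map_nil, List.cons.injEq, and_true] at hmap
  obtain ⟨h0, h1⟩ := hmap
  rw [hbf] at h1
  -- the first push normal `n = e'.nrm`
  have hn : ‖e'.nrm‖ = 1 := hSo'.2.1
  have hmenu' := hSo'.2.2.1
  have hfr' : e'.frame = twinFrame A e'.nrm := by rw [← hbf]; exact frame_eq_twinFrame_of_link hn hLi'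
  have hback : ∀ x, b.frame x = e'.frame x - (2 * ⟪e'.frame x, e'.nrm⟫_ℝ) • e'.nrm :=
    twin_symm b.frame e'.frame hn hLi'.1
  have hmenuA : ∀ w ∈ fccSlots, ⟪A w, e'.nrm⟫_ℝ = 0 ∨ ⟪A w, e'.nrm⟫_ℝ = Real.sqrt (2 / 3) ∨
      ⟪A w, e'.nrm⟫_ℝ = -Real.sqrt (2 / 3) := by
    rw [← hbf]; exact menu_reflect e'.frame b.frame hn hmenu' hback
  have hpos : ⟪A (slotSite 8), e'.nrm⟫_ℝ = Real.sqrt (2 / 3) := by rw [← hbf, ← hbd]; exact hLi'.2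
  have hκ₁u : ‖κ₁‖ = 1 := (hκl κ₁ (by simp)).1
  have hκ₀u : ‖κ₀‖ = 1 := (hκl κ₀ (by simp)).1
  have hlet0u : ‖A.symm e'.nrm‖ = 1 := by rw [LinearIsometryEquiv.norm_map, hn]
  -- letter 0 is `±κ₁`
  have e1 : A.symm e'.nrm = κ₁ ∨ A.symm e'.nrm = -κ₁ := eq_or_eq_neg_of_reflection_eq hlet0u hκ₁u h1
  rcases first_normal_cubic A hn hmenuA hpos with hPa | hPb
  · -- ray a: the second letter is `(1,−1,−1)/√3`
    have hpush : e' = forcedTop z b e'.nrm 0 := by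
      rw [forcedTop_zero]; exact head_eq_pushEntry hSo' hLi' hdir'
    rw [hb] at hpush
    have hnrm : e.nrm = nextNormal e' := nrm_eq_nextNormal hSo hLi hSo' hne
    have hNN : nextNormal e' = nextNormal (forcedTop z ⟨A, slotSite 8, 0⟩ e'.nrm 0) := congrArg nextNormal hpush
    have hlet1 : cubicCoords (e'.frame.symm e.nrm) = (Real.sqrt 3)⁻¹ • (![(1 : ℝ), -1, -1] : Fin 3 → ℝ) := by
      rw [hfr', hnrm, hNN]
      exact terrace_letter_one A hn hmenuA hpos hPa hZ ht
    have hlet1u : ‖e'.frame.symm e.nrm‖ = 1 := by rw [LinearIsometryEquiv.norm_map]; exact hSo.2.1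
    rcases eq_or_eq_neg_of_reflection_eq hlet1u hκ₀u h0 with h | h
    · exact hκ₀.1 (by rw [← h, hlet1])
    · refine hκ₀.2 ?_
      have h' : κ₀ = -(e'.frame.symm e.nrm) := by rw [h, neg_neg]
      rw [h', cubicCoords_neg, hlet1]
  · -- ray b: the first letter is `(−1,1,1)/√3 ≠ ±κ₁` (its first two cubic coordinates differ)
    have hneq : cubicCoords (A.symm e'.nrm) 0 ≠ cubicCoords (A.symm e'.nrm) 1 := by
      rw [hPb]
      simp only [Pi.smul_apply, smul_eq_mul, Matrix.cons_val_zero, Matrix.cons_val_one]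
      intro h
      have h3 : (Real.sqrt 3)⁻¹ = 0 := by linarith
      exact (inv_pos.2 hs3p).ne' h3
    have heq : cubicCoords (A.symm e'.nrm) 0 = cubicCoords (A.symm e'.nrm) 1 := by
      rcases e1 with h | h <;> rcases hκ₁ with hk | hk
      · rw [h, hk]; simp
      · rw [h, hk]; simp
      · rw [h, cubicCoords_neg, hk]; simp
      · rw [h, cubicCoords_neg, hk]; simp
    exact hneq heq

end Summit.Ventures.Crystal3D.Theorems

end
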